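import Summits.BirchSwinnertonDyer.BirchSwinnertonDyer.Theorems.AlignedTransportAtTwoBSDOfMainConjectureRankOneAtTwoEulerCharAtTwoAssemblyKummer
import Literature.NumberTheory.EllipticCurves.IwasawaNoFiniteSubmoduleProofs
import Literature.NumberTheory.EllipticCurves.Greenberg1999.NoProperFiniteIndexSubmodule
import HarnessLib

/-!
# Route `AlignedTransportAtTwo`, crux C3′ `BSDOfMainConjectureRankOneAtTwo` (stmt-BirchSwinnertonDyer-23008), line `birth` v5:
# no finite `Λ`-submodule ⇒ `H¹(Γ, Sel_∞)` is `p`-divisible ⇒ the derived Kummer map has TRIVIAL cokernel; on the C3′ cell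
# (mod Greenberg Prop. 4.14 / Hachimori–Matsuno at `2`, PRINT) the residual is ONE kernel order and ONE index

HONEST FRAMING (cell `bsd-f1-sign2`, attach seat `bsd-line-att-p4` g7 under the C3′ lead lineage `bsd-line-att-p1`;
`--supports stmt-BirchSwinnertonDyer-23008 --as helper`). BSD is NOT proved; C3′ is NOT closed; nothing is asserted. THEOREMS ONLY
(no `def`, no named fact, no `sorry`). Third file of the positive-rank assembly (`…EulerCharAtTwoAssembly` §1–§2,
`…EulerCharAtTwoAssemblyKummer` §3–§4).

* §5 (every `p`, every `ℤ_p`-extension of a number field, topological generator `γ`, any Pontryagin-dual datum `D`): if `X = X(E/K_∞)`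
  has no non-zero finite `Λ`-submodule then `(Sel_∞)_γ = H¹(Γ, Sel_{p^∞}(E/K_∞))` is `p`-DIVISIBLE (`exists_nsmul_eq_endCoinvariants`:
  Pontryagin `X[T] ≅ Hom((Sel_∞)_γ, ℚ/ℤ)` — tree `IsDualPair.exists_invariants_addEquiv` — turns a class outside `p·(Sel_∞)_γ` into a
  non-zero `p`-torsion element of `X[T]`, which «no finite submodule» forbids — tree `pow_smul_eq_zero_invariants_of_forall_finite_eq_bot`,
  Kitajima–Otsuki L.3.30 (2) / NSW 5.3.19 (ii)); hence EVERY FINITE QUOTIENT of `(Sel_∞)_γ` IS TRIVIAL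
  (`natCard_quotient_endCoinvariants_eq_one`: `p`-primary + `p`-divisible + finite). So the derived Kummer map `θ` of the assembly has
  `#coker θ = 1` whenever its cokernel is finite.
* §6 (`p = 2`, `W/ℚ` globally minimal, `IsOrdinaryAt W 2`, `E(ℚ)[2] = 0`, `2 ∤ #E(ℚ)_tors`; CONDITIONAL on the PRINT fact
  `Greenberg1999.prop414_noFiniteSubmodule_of_not_dvd_torsionOrder` = Greenberg Prop. 4.14 / Hachimori–Matsuno Cor. (i), valid at `2`):
  `schneiderLeadingTermFormulaAtTwoSqAt_iff_kerIndexAt_of_prop414` — **the open stub of C3′ read at a cell curve `W` ⟺ for every datum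
  and every choice of identifications: `θ` has finite kernel, trivial cokernel, and
  `#ker θ · #(A₀/Sel₀) · (log₂5)^{rank E(ℚ)} = u · Reg₂(Dh) · 2^{v₂(∏c_v)} · #Ẽ(𝔽₂)(2)²`**, `u ∈ ℤ₂ˣ`.

READING (nothing registered; lead's call). Curve by curve on the C3′ cell the residual at `2` is now: ONE kernel order `#ker θ` (the `2`-adic
size of the derived height on `E(ℚ) ⊗ ℚ₂/ℤ₂`, to be compared with `Reg₂/(log₂5)^r`: «algebraic height = Bockstein», Perrin-Riou 1992 §3.4 /
Schneider 1985, not in print at `2` over `ℚ`) and ONE index `#(A₀/Sel₀)` (to be compared with the local Euler factors: Greenberg Lemmas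
4.4/4.7). `Ш` and `coker θ` are gone.

References: [GreenbergLNM1716] §1 p. 60, Prop. 4.14, §4 Lemmas 4.2–4.7; [HachimoriMatsuno2000] Cor. (i); [NeukirchSchmidtWingberg2008]
Prop. 5.3.19 (ii); [KitajimaOtsuki2018] Lemma 3.30 (2); [CoatesSchneiderSujatha2003] p. 204; [PerrinRiou1992] §3.4.
bears_on: stmt-BirchSwinnertonDyer-23008 (helper; closes nothing), stmt-BirchSwinnertonDyer-22298 (attach seat's item; untouched).
-/

set_option autoImplicit false
-- the route's Theorems namespace repeats a component by design (summit = sub-problem, D-0017).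
set_option linter.dupNamespace false

noncomputable section

open scoped Classical

universe u

namespace Summit.BirchSwinnertonDyer.BirchSwinnertonDyer.Theorems.AlignedTransportAtTwoEulerCharAtTwoAssemblyDivisible

open Literature.NumberTheory.EllipticCurves Literature.NumberTheory.EllipticCurves.IwasawaAlgebra
  Literature.NumberTheory.EllipticCurves.IwasawaDual WeierstrassCurve
  Summit.BirchSwinnertonDyer.BirchSwinnertonDyer.Theorems.AlignedTransportAtTwoEulerCharAtTwoAssembly
  Summit.BirchSwinnertonDyer.BirchSwinnertonDyer.Theorems.AlignedTransportAtTwoEulerCharAtTwoAssemblyKummer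

/-! ## §5 No finite `Λ`-submodule ⇒ `H¹(Γ, Sel_∞)` is `p`-divisible ⇒ every finite quotient of it is trivial -/

section Divisible

variable {K : Type u} [Field K] [NumberField K] (W : WeierstrassCurve K) {p : ℕ} [Fact p.Prime]
  (κ : ZpExtension K p) {γ : Field.absoluteGaloisGroup K}

set_option maxHeartbeats 1000000 in
/-- **`X` has no non-zero finite `Λ`-submodule ⇒ `(Sel_∞)_γ = H¹(Γ, Sel_{p^∞}(E/K_∞))` is `p`-divisible.** Pontryagin: `X[T] ≅ Hom((Sel_∞)_γ, ℚ/ℤ)`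
(tree `IsDualPair.exists_invariants_addEquiv`); a class `q ∉ p·(Sel_∞)_γ` gives a character `χ ≠ 0` of `(Sel_∞)_γ/p` (`ℚ/ℤ` is a
cogenerator), i.e. a non-zero `p`-torsion element of `X[T]`, which the «no finite submodule» hypothesis forbids (tree
`pow_smul_eq_zero_invariants_of_forall_finite_eq_bot`, Kitajima–Otsuki L.3.30 (2) / NSW 5.3.19 (ii)).
[cite: GreenbergLNM1716, §1 p. 60, Prop. 4.14] [cite: NeukirchSchmidtWingberg2008, Prop. 5.3.19 (ii)] -/
theorem exists_nsmul_eq_endCoinvariants (hγ : κ.IsTopGenerator γ) (D : W.SelmerDualData κ γ)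
    (hnf : ∀ N : Submodule (IwasawaAlgebra p) D.X, Finite N → N = ⊥)
    (q : EndCoinvariants (W.conjSelmerInfty κ γ - 1)) :
    ∃ q' : EndCoinvariants (W.conjSelmerInfty κ γ - 1), p • q' = q := by
  by_contra hq
  obtain ⟨Φ, hΦ⟩ := (D.isDualPair W hγ).exists_invariants_addEquiv
  -- the subgroup `p·(Sel_∞)_γ`, the quotient by it, and a character detecting `q`
  obtain ⟨R, hR⟩ : ∃ R : AddSubgroup (EndCoinvariants (W.conjSelmerInfty κ γ - 1)),
      R = (DistribSMul.toAddMonoidHom (EndCoinvariants (W.conjSelmerInfty κ γ - 1)) p).range := ⟨_, rfl⟩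
  have hmemR : ∀ a : EndCoinvariants (W.conjSelmerInfty κ γ - 1), p • a ∈ R := fun a ↦ by
    rw [hR]; exact ⟨a, DistribSMul.toAddMonoidHom_apply _ _ _⟩
  have hqR : (QuotientAddGroup.mk q : EndCoinvariants (W.conjSelmerInfty κ γ - 1) ⧸ R) ≠ 0 := by
    intro h
    rw [QuotientAddGroup.eq_zero_iff, hR] at h
    obtain ⟨q', hq'⟩ := h
    exact hq ⟨q', by rw [← hq', DistribSMul.toAddMonoidHom_apply]⟩
  obtain ⟨χbar, hχbar⟩ := CharacterModule.exists_character_apply_ne_zero_of_ne_zero hqR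
  obtain ⟨χ, hχq, hχp⟩ : ∃ χ : CharacterModule (EndCoinvariants (W.conjSelmerInfty κ γ - 1)),
      χ q ≠ 0 ∧ ∀ a, χ (p • a) = 0 :=
    ⟨χbar.comp (QuotientAddGroup.mk' R), hχbar, fun a ↦ by
      show χbar (QuotientAddGroup.mk' R (p • a)) = 0
      rw [QuotientAddGroup.mk'_apply, (QuotientAddGroup.eq_zero_iff _).mpr (hmemR a), map_zero]⟩
  -- the corresponding element `x` of `X[T]`: `toDual x s = χ [s]`, so `toDual (p • x) = 0`, so `p • x = 0`, so `x = 0`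
  have hxχ : ∀ s : W.selmerInfty κ, D.toDual ((Φ.symm χ : invariants p D.X) : D.X) s =
      χ (s : EndCoinvariants (W.conjSelmerInfty κ γ - 1)) := fun s ↦ by
    rw [← hΦ (Φ.symm χ) s, AddEquiv.apply_symm_apply]
  have hx : (p ^ 1 : ℕ) • ((Φ.symm χ : invariants p D.X) : D.X) = 0 := by
    rw [pow_one]
    apply D.bijective.1
    rw [map_nsmul, map_zero]
    refine AddMonoidHom.ext fun s ↦ ?_
    rw [AddMonoidHom.nsmul_apply, AddMonoidHom.zero_apply, hxχ, ← map_nsmul]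
    exact hχp _
  have h0 := pow_smul_eq_zero_invariants_of_forall_finite_eq_bot p hnf (Φ.symm χ).2 hx
  have h0' : Φ.symm χ = 0 := Subtype.ext h0
  rw [AddEquiv.map_eq_zero_iff] at h0'
  exact hχq (by rw [h0']; rfl)

set_option maxHeartbeats 1000000 in
/-- **Hence every FINITE quotient of `H¹(Γ, Sel_{p^∞}(E/K_∞))` is trivial** when `X` has no non-zero finite `Λ`-submodule: the quotient is
`p`-primary (every class of `H¹(K_∞, E[p^∞])` is killed by a power of `p`, tree `exists_pow_smul_subgroupH1_ker_eq_zero`) and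
`p`-divisible (`exists_nsmul_eq_endCoinvariants`), and on a finite group a surjective `p·` is injective. In particular the derived
Kummer map `θ` of the assembly has `#coker θ = 1` as soon as its cokernel is finite. [cite: GreenbergLNM1716, §1 p. 60, Prop. 4.14] -/
theorem natCard_quotient_endCoinvariants_eq_one (hγ : κ.IsTopGenerator γ) (D : W.SelmerDualData κ γ)
    (hnf : ∀ N : Submodule (IwasawaAlgebra p) D.X, Finite N → N = ⊥)
    (R : AddSubgroup (EndCoinvariants (W.conjSelmerInfty κ γ - 1)))
    (hfin : Finite (EndCoinvariants (W.conjSelmerInfty κ γ - 1) ⧸ R)) :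
    Nat.card (EndCoinvariants (W.conjSelmerInfty κ γ - 1) ⧸ R) = 1 := by
  haveI := hfin
  have hp : p.Prime := Fact.out
  -- `p`-primary
  have hprim : ∀ a : EndCoinvariants (W.conjSelmerInfty κ γ - 1) ⧸ R, ∃ k : ℕ, p ^ k • a = 0 := by
    intro a
    induction a using QuotientAddGroup.induction_on with
    | H q =>
      induction q using QuotientAddGroup.induction_on with
      | H s =>
        obtain ⟨k, hk⟩ := W.exists_pow_smul_subgroupH1_ker_eq_zero κ (s : W.subgroupH1 p κ.kerSubgroup)
        refine ⟨k, ?_⟩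
        have hs : p ^ k • s = 0 := Subtype.ext (by rw [AddSubgroupClass.coe_nsmul, hk, ZeroMemClass.coe_zero])
        rw [← QuotientAddGroup.mk_nsmul, ← QuotientAddGroup.mk_nsmul, hs, QuotientAddGroup.mk_zero, QuotientAddGroup.mk_zero]
  -- `p`-divisible
  have hdiv : Function.Surjective (fun b : EndCoinvariants (W.conjSelmerInfty κ γ - 1) ⧸ R ↦ p • b) := by
    intro a
    induction a using QuotientAddGroup.induction_on with
    | H q =>
      obtain ⟨q', hq'⟩ := exists_nsmul_eq_endCoinvariants W κ hγ D hnf q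
      exact ⟨QuotientAddGroup.mk q', by simp only [← QuotientAddGroup.mk_nsmul, hq']⟩
  have hinj : Function.Injective (fun b : EndCoinvariants (W.conjSelmerInfty κ γ - 1) ⧸ R ↦ p • b) :=
    Finite.injective_iff_surjective.mpr hdiv
  -- so everything is `0`
  have key : ∀ (k : ℕ) (a : EndCoinvariants (W.conjSelmerInfty κ γ - 1) ⧸ R), p ^ k • a = 0 → a = 0 := by
    intro k
    induction k with
    | zero => intro a ha; simpa using ha
    | succ k ih =>
      intro a ha
      rw [pow_succ', mul_smul] at ha
      exact ih a (hinj (by simpa using ha))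
  rw [Nat.card_eq_one_iff_unique]
  exact ⟨⟨fun a b ↦ by
    obtain ⟨k, hk⟩ := hprim a
    obtain ⟨m, hm⟩ := hprim b
    rw [key k a hk, key m b hm]⟩, ⟨0⟩⟩

end Divisible

/-! ## §6 On the C3′ cell (mod Greenberg Prop. 4.14 / Hachimori–Matsuno at `2`, PRINT): `#coker θ = 1`, so the `Ш`-free residual is
`#ker θ · #(A₀/Sel₀) · (log₂5)^r = u · Reg₂ · 2^{v₂(∏c_v)} · #Ẽ(𝔽₂)(2)²` -/

section CellAtTwo

open Literature.NumberTheory.EllipticCurves.Greenberg1999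

variable (W : WeierstrassCurve ℚ) [W.IsElliptic] [W.IsGloballyMinimal]

set_option maxHeartbeats 2000000 in
/-- **THE OPEN STUB OF C3′ AT A CELL CURVE ⟺ THE KERNEL-INDEX IDENTITY (CONDITIONAL on Greenberg Prop. 4.14 / Hachimori–Matsuno Cor. (i)
at `p = 2`, PRINT at every `p`, hypothesis `h414`; closes nothing).** For `W/ℚ` globally minimal, `IsOrdinaryAt W 2`, `E(ℚ)[2] = 0` and
`2 ∤ #E(ℚ)_tors` (both = the cell binder «no rational `2`-torsion abscissa», tree `…EulerCharAtTwoCellIndex.not_two_dvd_torsionOrder_…`):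
`SchneiderLeadingTermFormulaAtTwoSqAt W` holds IFF for every cyclotomic datum, every finitely generated torsion strict dual `D`, THE `Σ²` height
`Dh` with `Reg₂(Dh) ≠ 0`, `Ш(E/ℚ)(2)` finite, and every `e`, `e₀`, `κ : M ↪ Sel_{2^∞}(E/ℚ)` (cokernel of order `#Ш(2)`), the derived Kummer
map `θ` has finite kernel, TRIVIAL cokernel, and **`#ker θ · #(A₀/Sel₀) · (log₂5)^{rank E(ℚ)} = u · Reg₂(Dh) · 2^{v₂(∏c_v)} · #Ẽ(𝔽₂)(2)²`**,
`u ∈ ℤ₂ˣ`: by `schneiderLeadingTermFormulaAtTwoSqAt_iff_shaFreeAt` and `#coker θ = 1` (`natCard_quotient_endCoinvariants_eq_one`, the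
no-finite-submodule input being Prop. 4.14 at `2` through `2 ∤ #E(ℚ)_tors`). READING: the residual of C3′ at a cell curve is ONE kernel order
`#ker θ` (the `2`-adic size of the derived height on `E(ℚ) ⊗ ℚ₂/ℤ₂`) and ONE index `#(A₀/Sel₀)` against `Reg₂·(local Euler factors)`.
[cite: GreenbergLNM1716, Prop. 4.14, §4 Lemmas 4.2–4.7] [cite: HachimoriMatsuno2000, Cor. (i)] [cite: CoatesSchneiderSujatha2003, p. 204]
[cite: PerrinRiou1992, §3.4] -/
theorem schneiderLeadingTermFormulaAtTwoSqAt_iff_kerIndexAt_of_prop414 (h414 : prop414_noFiniteSubmodule_of_not_dvd_torsionOrder)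
    (hK : ∀ P : W.toAffine.Point, 2 • P = 0 → P = 0) (h2 : ¬ 2 ∣ W.torsionOrder) (hord : IsOrdinaryAt W 2) :
    Summit.BirchSwinnertonDyer.Rank1Residual.F1Sign2.SchneiderLeadingTermFormulaAtTwoSqAt W ↔
    (∀ (κ : ZpExtension ℚ 2) (γ : Field.absoluteGaloisGroup ℚ),
        κ.IsCyclotomic → κ.IsTopGenerator γ → IsCyclotomicVariable 2 γ →
      ∀ (D : W.SelmerDualData κ γ) [Module.Finite (IwasawaAlgebra 2) D.X], D.IsTorsion →
      ∀ (Dh : PAdicHeightData W 2), Dh.IsCanonicalSq →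
        SchneiderConjecture Dh → Finite (AddCommGroup.primaryComponent W.sha 2) →
      ∀ (e : ↥(W.selmerInfty κ ⊓ W.layerInvariants κ 0) ≃+ ↥(endInvariants (W.conjSelmerInfty κ γ - 1)))
        (e₀ : ↥(W.selmerGroupPInfty 2) ≃+ ↥(W.selmerLayer κ 0))
        (M : Type) [AddCommGroup M] (kS : M →+ ↥(W.selmerGroupPInfty 2)), Function.Injective kS →
        Nat.card (↥(W.selmerGroupPInfty 2) ⧸ kS.range) = Nat.card (AddCommGroup.primaryComponent W.sha 2) →
      ∀ (θ : M →+ EndCoinvariants (W.conjSelmerInfty κ γ - 1)),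
        θ = (W.selmerInftyEulerMap κ γ).comp
          (((e : ↥(W.selmerInfty κ ⊓ W.layerInvariants κ 0) →+ ↥(endInvariants (W.conjSelmerInfty κ γ - 1))).comp (W.sMap κ 0)).comp
            ((e₀ : ↥(W.selmerGroupPInfty 2) →+ ↥(W.selmerLayer κ 0)).comp kS)) →
        Finite θ.ker ∧ Nat.card (EndCoinvariants (W.conjSelmerInfty κ γ - 1) ⧸ θ.range) = 1 ∧
        ∃ u : ℤ_[2]ˣ,
          (Nat.card θ.ker : ℚ_[2]) * Nat.card (W.KerG κ 0) * padicLog 2 (cyclotomicGenerator 2) ^ W.mordellWeilRank =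
            ((u : ℤ_[2]) : ℚ_[2]) * padicRegulator Dh * (2 : ℚ_[2]) ^ (padicValNat 2 W.tamagawaProduct) *
              (Nat.card (AddCommGroup.primaryComponent
                ((integralModelInt W).map (Int.castRingHom (ZMod 2))).toAffine.Point 2) : ℚ_[2]) ^ 2) := by
  refine (schneiderLeadingTermFormulaAtTwoSqAt_iff_shaFreeAt W hK hord).trans ⟨?_, ?_⟩
  · intro h κ γ hκ hγ hγ' D _ hX Dh hDh hS hSha e e₀ M _ kS hkS hkS' θ hθ
    obtain ⟨hk, hc, u, hu⟩ := h κ γ hκ hγ hγ' D hX Dh hDh hS hSha e e₀ M kS hkS hkS' θ hθ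
    have h1 : Nat.card (EndCoinvariants (W.conjSelmerInfty κ γ - 1) ⧸ θ.range) = 1 :=
      natCard_quotient_endCoinvariants_eq_one W κ hγ D (h414 W 2 h2 κ γ hκ hγ D hX) θ.range hc
    refine ⟨hk, h1, u, ?_⟩
    rw [h1, Nat.cast_one, mul_one] at hu
    exact hu
  · intro h κ γ hκ hγ hγ' D _ hX Dh hDh hS hSha e e₀ M _ kS hkS hkS' θ hθ
    obtain ⟨hk, h1, u, hu⟩ := h κ γ hκ hγ hγ' D hX Dh hDh hS hSha e e₀ M kS hkS hkS' θ hθ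
    have hc : Finite (EndCoinvariants (W.conjSelmerInfty κ γ - 1) ⧸ θ.range) :=
      Nat.finite_of_card_ne_zero (by rw [h1]; exact one_ne_zero)
    refine ⟨hk, hc, u, ?_⟩
    rw [h1, Nat.cast_one, mul_one]
    exact hu

end CellAtTwo

end Summit.BirchSwinnertonDyer.BirchSwinnertonDyer.Theorems.AlignedTransportAtTwoEulerCharAtTwoAssemblyDivisible

end
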